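import Literature.Geometry.Riemannian.SegmentInequalityPoincareSq
import Literature.Geometry.Riemannian.BishopGromovRelativeVolume
import HarnessLib

/-!
# The Dirichlet–Poincaré (Friedrichs) inequality on balls under `Ric ≥ -(d-1)`

Coercivity of the Dirichlet energy on functions supported in a ball — the input of the
variational (`H¹₀`) solution of the Dirichlet problem on balls used throughout the Cheeger–Colding
theory (harmonic replacements of distance functions, Cheeger–Colding 1996, §6; 2000, §1): on a
connected complete Riemannian `d`-manifold with `Ric ≥ -(d-1) g`, for `u ∈ C^∞` vanishing outside
the ball `B_r(p)`,

  `Vol(B_{2r}(p) ∖ B_r(p)) · ∫_M u² ≤ K(r) · Vol(B_{2r}(p)) · ∫_M |∇u|²`,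
  `K(r) = 4r · (2 cosh 2r)^{d-1} · 4r · 2`

(`lintegral_sq_le_of_support_subset_ball`), from the (2,2)-Poincaré inequality of
`SegmentInequalityPoincareSq.lean` on `B_{2r}(p)` (pairs `(x, y)` with `y` in the annulus, where
`u(y) = 0`, contribute `Vol(annulus) ∫ u²`). When the annulus contains a ball `B_{r/2}(q)`
(`d(p, q) = 3r/2`; such `q` exists as soon as some point is at distance `≥ 3r/2` from `p`),
relative volume comparison bounds `Vol B_{2r}(p) / Vol(annulus) ≤ Vol B_{4r}(q) / Vol B_{r/2}(q)`
by the Bishop–Gromov ratio, giving the Friedrichs inequality `∫ u² ≤ C(d, r) ∫ |∇u|²` with an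
explicit constant (`lintegral_sq_le_mul_lintegral_gradSq_of_support_subset_ball`).

No definitions, no named facts (D-0026). Groundwork for `CheegerColding1997_sphereStability`.

## References

* J. Cheeger, T. H. Colding, Ann. of Math. 144 (1996) 189–237, §2 (segment inequality ⇒
  Poincaré) and §6. [CheegerColding1996]
* P. Buser, Ann. Sci. ÉNS 15 (1982) 213–230, §5. [Buser1982]
-/

noncomputable section

open Bundle Set Function Filter MeasureTheory
open scoped Manifold ContDiff Topology ENNReal NNReal Real

namespace Literature.Geometry.Riemannian

open Lorentzian Lorentzian.PseudoRiemannianMetric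

section DirichletPoincare

variable {d : ℕ} {M : Type*} [TopologicalSpace M] [ChartedSpace (EuclideanSpace ℝ (Fin d)) M]
  [IsManifold 𝓘(ℝ, EuclideanSpace ℝ (Fin d)) ∞ M] [T2Space M]
  (g : PseudoRiemannianMetric 𝓘(ℝ, EuclideanSpace ℝ (Fin d)) ∞ (EuclideanSpace ℝ (Fin d))
    (TangentSpace 𝓘(ℝ, EuclideanSpace ℝ (Fin d)) : M → Type _)) [g.HasLeviCivita]
  [CovariantDerivative.ContMDiffCovariantDerivative g.leviCivita 1]
  [CovariantDerivative.ContMDiffCovariantDerivative g.leviCivita ∞]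

/-- **Dirichlet–Poincaré inequality on balls, annulus form**: under `Ric ≥ -(d-1) g` on a
connected complete Riemannian `d`-manifold, for `u ∈ C^∞` vanishing outside `B_r(p)`,
`Vol(B_{2r}(p) ∖ B_r(p)) ∫_M u² ≤ 4r (2cosh 2r)^{d-1} 4r · 2 Vol(B_{2r}(p)) ∫_M |∇u|²`.
[cite: CheegerColding1996, §2, Remark 2.82] [cite: Buser1982, Lemma 5.1] -/
theorem lintegral_sq_le_of_support_subset_ball (hd : 0 < d) [ConnectedSpace M] [T3Space M]
    [SecondCountableTopology M] [MeasurableSpace M] [BorelSpace M] (hg : g.IsRiemannian)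
    (hc : IsGeodesicallyComplete g.leviCivita)
    (hRic : ∀ (x : M) (w : TangentSpace 𝓘(ℝ, (EuclideanSpace ℝ (Fin d))) x),
      -((d : ℝ) - 1) * g.val x w w ≤ g.leviCivita.ricci x w w)
    {u : M → ℝ} (hu : ContMDiff 𝓘(ℝ, (EuclideanSpace ℝ (Fin d))) 𝓘(ℝ, ℝ) ∞ u)
    (p : M) {r : ℝ} (hr : 0 < r)
    (hsupp : ∀ x, ENNReal.ofReal r ≤ g.edist hg p x → u x = 0) :
    (riemannianMeasure (I := 𝓘(ℝ, (EuclideanSpace ℝ (Fin d)))) (g.toContMDiffRiemannianMetric hg))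
        ({x : M | g.edist hg p x < ENNReal.ofReal (2 * r)} ∩ {x | ENNReal.ofReal r ≤ g.edist hg p x}) *
      ∫⁻ x, ENNReal.ofReal (u x ^ 2)
        ∂(riemannianMeasure (I := 𝓘(ℝ, (EuclideanSpace ℝ (Fin d)))) (g.toContMDiffRiemannianMetric hg)) ≤
    ENNReal.ofReal (2 * (2 * r)) *
      (ENNReal.ofReal ((2 * Real.cosh (2 * r)) ^ (d - 1)) * ENNReal.ofReal (2 * (2 * r)) *
        (2 * (riemannianMeasure (I := 𝓘(ℝ, (EuclideanSpace ℝ (Fin d))))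
            (g.toContMDiffRiemannianMetric hg)) {x : M | g.edist hg p x < ENNReal.ofReal (2 * r)}) *
        ∫⁻ y, ENNReal.ofReal (g.gradSq u y)
          ∂(riemannianMeasure (I := 𝓘(ℝ, (EuclideanSpace ℝ (Fin d))))
            (g.toContMDiffRiemannianMetric hg))) := by
  haveI : LocallyCompactSpace M :=
    Manifold.locallyCompact_of_finiteDimensional 𝓘(ℝ, (EuclideanSpace ℝ (Fin d)))
  haveI : SigmaCompactSpace M := inferInstance
  set μ := riemannianMeasure (I := 𝓘(ℝ, (EuclideanSpace ℝ (Fin d))))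
    (g.toContMDiffRiemannianMetric hg) with hμ
  haveI : IsFiniteMeasureOnCompacts μ :=
    ⟨fun K hK ↦ riemannianVolume_lt_top_of_isCompact_holds (g.toContMDiffRiemannianMetric hg) le_rfl hK⟩
  haveI : SigmaFinite μ := inferInstance
  set B : Set M := {x : M | g.edist hg p x < ENNReal.ofReal (2 * r)} with hB
  set A : Set M := B ∩ {x | ENNReal.ofReal r ≤ g.edist hg p x} with hA
  have key := setLIntegral_prod_sq_sub_le_gradient g hd hg hc hRic hu p (by linarith : 0 < 2 * r)
  rw [← hμ, ← hB] at key
  -- measurability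
  have hρm : Measurable fun x ↦ g.edist hg p x :=
    ((PseudoRiemannianMetric.continuous_edist hg).comp (Continuous.prodMk_right p)).measurable
  have hBm : MeasurableSet B := measurableSet_lt hρm measurable_const
  have hAm : MeasurableSet A := hBm.inter (measurableSet_le measurable_const hρm)
  have hAB : A ⊆ B := inter_subset_left
  have hum : Measurable u := hu.continuous.measurable
  -- `u = 0` off `B_r`, in particular on `A` and off `B`
  have huA : ∀ y ∈ A, u y = 0 := fun y hy ↦ hsupp y hy.2
  have huB : ∀ x, x ∉ B → u x = 0 := fun x hx ↦ by
    refine hsupp x ?_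
    simp only [hB, mem_setOf_eq, not_lt] at hx
    exact (ENNReal.ofReal_le_ofReal (by linarith)).trans hx
  -- lower bound of the double integral: pairs `(x, y) ∈ B × A`
  have hlow : μ A * ∫⁻ x, ENNReal.ofReal (u x ^ 2) ∂μ ≤
      ∫⁻ z in B ×ˢ B, ENNReal.ofReal (|u z.1 - u z.2| ^ 2) ∂(μ.prod μ) := by
    have h1 : ∫⁻ x, ENNReal.ofReal (u x ^ 2) ∂μ = ∫⁻ x in B, ENNReal.ofReal (u x ^ 2) ∂μ := by
      rw [← lintegral_indicator hBm]
      refine lintegral_congr fun x ↦ ?_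
      by_cases hx : x ∈ B
      · rw [indicator_of_mem hx]
      · rw [indicator_of_notMem hx, huB x hx]; simp
    have h2 : ∫⁻ z in B ×ˢ B, ENNReal.ofReal (|u z.1 - u z.2| ^ 2) ∂(μ.prod μ) =
        ∫⁻ x in B, ∫⁻ y in B, ENNReal.ofReal (|u x - u y| ^ 2) ∂μ ∂μ := by
      rw [← Measure.prod_restrict, lintegral_prod]
      exact (ENNReal.measurable_ofReal.comp ((continuous_abs.comp
        ((hu.continuous.comp continuous_fst).sub (hu.continuous.comp continuous_snd))).pow 2
          |>.measurable)).aemeasurable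
    rw [h1, h2]
    have hmeas : Measurable fun x ↦ ENNReal.ofReal (u x ^ 2) :=
      ENNReal.measurable_ofReal.comp ((hu.continuous.pow 2).measurable)
    rw [← lintegral_const_mul (μ A) hmeas]
    refine setLIntegral_mono' hBm fun x _ ↦ ?_
    calc μ A * ENNReal.ofReal (u x ^ 2) = ∫⁻ _y in A, ENNReal.ofReal (u x ^ 2) ∂μ := by
          rw [setLIntegral_const, mul_comm]
      _ = ∫⁻ y in A, ENNReal.ofReal (|u x - u y| ^ 2) ∂μ := by
          refine setLIntegral_congr_fun hAm fun y hy ↦ ?_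
          rw [huA y hy, sub_zero, sq_abs]
      _ ≤ ∫⁻ y in B, ENNReal.ofReal (|u x - u y| ^ 2) ∂μ := lintegral_mono_set hAB
  -- the gradient integral over `B_{4r}` is at most the one over `M`
  have hgrad : ∫⁻ y in {x : M | g.edist hg p x < ENNReal.ofReal (2 * (2 * r))},
      ENNReal.ofReal (g.gradSq u y) ∂μ ≤ ∫⁻ y, ENNReal.ofReal (g.gradSq u y) ∂μ :=
    setLIntegral_le_lintegral _ _
  calc μ A * ∫⁻ x, ENNReal.ofReal (u x ^ 2) ∂μ
      ≤ ∫⁻ z in B ×ˢ B, ENNReal.ofReal (|u z.1 - u z.2| ^ 2) ∂(μ.prod μ) := hlow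
    _ ≤ _ := key
    _ ≤ _ := by gcongr

/-- **Friedrichs inequality on balls with an explicit constant**: if moreover some point `q` has
`d(p, q) = 3r/2`, then `B_{r/2}(q) ⊆ B_{2r}(p) ∖ B_r(p)` and `B_{2r}(p) ⊆ B_{4r}(q)`, so by
relative volume comparison (`BishopGromovRelativeVolume`: `Vol B_{4r}(q) ≤ Λ Vol B_{r/2}(q)` with
`Λ = V(4r)/V(r/2)` the model ratio) `∫_M u² ≤ K(r) Λ ∫_M |∇u|²` for `u ∈ C^∞` vanishing outside
`B_r(p)`. Stated with the volume ratio hypothesis `Vol B_{4r}(q) ≤ Λ Vol B_{r/2}(q)` explicit.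
[cite: CheegerColding1996, §2, Remark 2.82] [cite: Buser1982, Lemma 5.1] -/
theorem lintegral_sq_le_mul_lintegral_gradSq_of_support_subset_ball (hd : 0 < d) [ConnectedSpace M]
    [T3Space M] [SecondCountableTopology M] [MeasurableSpace M] [BorelSpace M] (hg : g.IsRiemannian)
    (hc : IsGeodesicallyComplete g.leviCivita)
    (hRic : ∀ (x : M) (w : TangentSpace 𝓘(ℝ, (EuclideanSpace ℝ (Fin d))) x),
      -((d : ℝ) - 1) * g.val x w w ≤ g.leviCivita.ricci x w w)
    {u : M → ℝ} (hu : ContMDiff 𝓘(ℝ, (EuclideanSpace ℝ (Fin d))) 𝓘(ℝ, ℝ) ∞ u)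
    (p : M) {r : ℝ} (hr : 0 < r)
    (hsupp : ∀ x, ENNReal.ofReal r ≤ g.edist hg p x → u x = 0)
    {q : M} (hq : g.edist hg p q = ENNReal.ofReal (3 * r / 2)) {Λ : ℝ≥0∞}
    (hΛ : (riemannianMeasure (I := 𝓘(ℝ, (EuclideanSpace ℝ (Fin d)))) (g.toContMDiffRiemannianMetric hg))
        {x : M | g.edist hg q x < ENNReal.ofReal (4 * r)} ≤
      Λ * (riemannianMeasure (I := 𝓘(ℝ, (EuclideanSpace ℝ (Fin d))))
        (g.toContMDiffRiemannianMetric hg)) {x : M | g.edist hg q x < ENNReal.ofReal (r / 2)}) :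
    ∫⁻ x, ENNReal.ofReal (u x ^ 2)
        ∂(riemannianMeasure (I := 𝓘(ℝ, (EuclideanSpace ℝ (Fin d)))) (g.toContMDiffRiemannianMetric hg)) ≤
    ENNReal.ofReal (2 * (2 * r)) *
      (ENNReal.ofReal ((2 * Real.cosh (2 * r)) ^ (d - 1)) * ENNReal.ofReal (2 * (2 * r)) * (2 * Λ) *
        ∫⁻ y, ENNReal.ofReal (g.gradSq u y)
          ∂(riemannianMeasure (I := 𝓘(ℝ, (EuclideanSpace ℝ (Fin d))))
            (g.toContMDiffRiemannianMetric hg))) := by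
  set μ := riemannianMeasure (I := 𝓘(ℝ, (EuclideanSpace ℝ (Fin d))))
    (g.toContMDiffRiemannianMetric hg) with hμ
  have key := lintegral_sq_le_of_support_subset_ball g hd hg hc hRic hu p hr hsupp
  rw [← hμ] at key
  set A : Set M := {x : M | g.edist hg p x < ENNReal.ofReal (2 * r)} ∩
    {x | ENNReal.ofReal r ≤ g.edist hg p x} with hA
  -- `B_{r/2}(q) ⊆ A` and `B_{2r}(p) ⊆ B_{4r}(q)` (triangle inequality)
  have htri : ∀ x y z : M, g.edist hg x z ≤ g.edist hg x y + g.edist hg y z :=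
    fun x y z ↦ g.edist_triangle hg x y z
  have hsub1 : {x : M | g.edist hg q x < ENNReal.ofReal (r / 2)} ⊆ A := by
    intro x hx
    simp only [mem_setOf_eq] at hx
    have hqx : (g.edist hg q x).toReal < r / 2 :=
      (ENNReal.lt_ofReal_iff_toReal_lt (edist_ne_top hg q x)).1 hx
    have hpq : (g.edist hg p q).toReal = 3 * r / 2 := by
      rw [hq, ENNReal.toReal_ofReal (by linarith)]
    have h1 : (g.edist hg p x).toReal ≤ (g.edist hg p q).toReal + (g.edist hg q x).toReal := by
      have h := ENNReal.toReal_mono (ENNReal.add_ne_top.2 ⟨edist_ne_top hg p q, edist_ne_top hg q x⟩)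
        (htri p q x)
      rwa [ENNReal.toReal_add (edist_ne_top hg p q) (edist_ne_top hg q x)] at h
    have h2 : (g.edist hg p q).toReal ≤ (g.edist hg p x).toReal + (g.edist hg x q).toReal := by
      have h := ENNReal.toReal_mono (ENNReal.add_ne_top.2 ⟨edist_ne_top hg p x, edist_ne_top hg x q⟩)
        (htri p x q)
      rwa [ENNReal.toReal_add (edist_ne_top hg p x) (edist_ne_top hg x q)] at h
    rw [g.edist_comm hg x q] at h2
    refine ⟨?_, ?_⟩
    · show g.edist hg p x < ENNReal.ofReal (2 * r)
      exact (ENNReal.lt_ofReal_iff_toReal_lt (edist_ne_top hg p x)).2 (by linarith)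
    · show ENNReal.ofReal r ≤ g.edist hg p x
      exact (ENNReal.ofReal_le_iff_le_toReal (edist_ne_top hg p x)).2 (by linarith)
  have hsub2 : {x : M | g.edist hg p x < ENNReal.ofReal (2 * r)} ⊆
      {x : M | g.edist hg q x < ENNReal.ofReal (4 * r)} := by
    intro x hx
    simp only [mem_setOf_eq] at hx ⊢
    have hpx : (g.edist hg p x).toReal < 2 * r :=
      (ENNReal.lt_ofReal_iff_toReal_lt (edist_ne_top hg p x)).1 hx
    have hpq : (g.edist hg q p).toReal = 3 * r / 2 := by
      rw [g.edist_comm hg q p, hq, ENNReal.toReal_ofReal (by linarith)]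
    have h1 : (g.edist hg q x).toReal ≤ (g.edist hg q p).toReal + (g.edist hg p x).toReal := by
      have h := ENNReal.toReal_mono (ENNReal.add_ne_top.2 ⟨edist_ne_top hg q p, edist_ne_top hg p x⟩)
        (htri q p x)
      rwa [ENNReal.toReal_add (edist_ne_top hg q p) (edist_ne_top hg p x)] at h
    exact (ENNReal.lt_ofReal_iff_toReal_lt (edist_ne_top hg q x)).2 (by linarith)
  -- volume bookkeeping
  have hvolB : μ {x : M | g.edist hg p x < ENNReal.ofReal (2 * r)} ≤ Λ * μ A :=
    (measure_mono hsub2).trans (hΛ.trans (mul_le_mul_right (measure_mono hsub1) Λ))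
  have hApos : μ A ≠ 0 := by
    haveI : μ.IsOpenPosMeasure := isOpenPosMeasure_riemannianMeasure _
    have hqr : q ∈ {x : M | g.edist hg q x < ENNReal.ofReal (r / 2)} := by
      simp only [mem_setOf_eq, PseudoRiemannianMetric.edist_self]
      exact ENNReal.ofReal_pos.2 (by linarith)
    have hopen : IsOpen {x : M | g.edist hg q x < ENNReal.ofReal (r / 2)} :=
      isOpen_lt ((PseudoRiemannianMetric.continuous_edist hg).comp (Continuous.prodMk_right q))
        continuous_const
    exact fun h0 ↦ (hopen.measure_pos μ ⟨q, hqr⟩).ne' (measure_mono_null hsub1 h0)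
  have hAtop : μ A ≠ ⊤ := by
    haveI : LocallyCompactSpace M := Manifold.locallyCompact_of_finiteDimensional
      (𝓘(ℝ, (EuclideanSpace ℝ (Fin d))))
    haveI : IsFiniteMeasureOnCompacts μ :=
      ⟨fun K hK ↦ riemannianVolume_lt_top_of_isCompact_holds (g.toContMDiffRiemannianMetric hg)
        le_rfl hK⟩
    refine (lt_of_le_of_lt (measure_mono inter_subset_left) ?_).ne
    set ρ : ℝ≥0 := ⟨2 * r, by linarith⟩ with hρ
    have hsub : {x : M | g.edist hg p x < ENNReal.ofReal (2 * r)} ⊆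
        {x : M | g.edist hg p x ≤ (ρ : ℝ≥0∞)} := fun x hx ↦ by
      simp only [mem_setOf_eq] at hx ⊢
      rw [ENNReal.ofReal_eq_coe_nnreal (by linarith : (0 : ℝ) ≤ 2 * r)] at hx
      exact hx.le
    exact lt_of_le_of_lt (measure_mono hsub)
      (isCompact_setOf_edist_le g le_rfl hg hc p ρ).measure_lt_top
  -- divide by `μ A`
  have h1 : μ A * ∫⁻ x, ENNReal.ofReal (u x ^ 2) ∂μ ≤
      μ A * (ENNReal.ofReal (2 * (2 * r)) *
        (ENNReal.ofReal ((2 * Real.cosh (2 * r)) ^ (d - 1)) * ENNReal.ofReal (2 * (2 * r)) * (2 * Λ) *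
          ∫⁻ y, ENNReal.ofReal (g.gradSq u y) ∂μ)) := by
    refine key.trans ?_
    calc ENNReal.ofReal (2 * (2 * r)) *
          (ENNReal.ofReal ((2 * Real.cosh (2 * r)) ^ (d - 1)) * ENNReal.ofReal (2 * (2 * r)) *
            (2 * μ {x : M | g.edist hg p x < ENNReal.ofReal (2 * r)}) *
            ∫⁻ y, ENNReal.ofReal (g.gradSq u y) ∂μ)
        ≤ ENNReal.ofReal (2 * (2 * r)) *
          (ENNReal.ofReal ((2 * Real.cosh (2 * r)) ^ (d - 1)) * ENNReal.ofReal (2 * (2 * r)) *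
            (2 * (Λ * μ A)) * ∫⁻ y, ENNReal.ofReal (g.gradSq u y) ∂μ) := by gcongr
      _ = _ := by ring
  exact (ENNReal.mul_le_mul_iff_right hApos hAtop).1 h1

end DirichletPoincare

end Literature.Geometry.Riemannian

end
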